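import Summits.Ventures.PercRepro.S2RowFifteenOpenTwo
import Summits.Ventures.PercRepro.S2FifteenSeven

/-!
# PercRepro — S2: THE `p = 15` ROW — THE ONE OPEN CELL AS ONE HYPOTHESIS (p7, gen 12; sub-claim S2)

With `(15, 7)` a tree theorem (S2FifteenSeven: the concentrated tail and the triangle trade-off), the «16» assembly needs only the cell
`(15, 6)`: **`c025_five_large_sharp16_of_one_cell`** — C-025 at level `5` for every `p ≥ 16` from `RLS M 15 5` on the `e`-free cores of
rank `15` on `21` points. That cell is priced OPEN in its spread case with `≥ 5` triangles (the cobasis view of the `6`-set charge reads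
1.001 / 1.011 at `s₃ = 9, 10`; S2 v36 §R3⁗(u)). Nothing here asserts a window move. Axioms: standard.
-/

open scoped Matroid

namespace PercRepro

namespace ThmN

variable {α : Type}

/-- **THEOREM C₅ AT `16` MODULO THE ONE OPEN CELL** `(15, 6)`. -/
theorem c025_five_large_sharp16_of_one_cell
    (hsix : ∀ (M : Matroid α) [M.Finite], M.eRank = ((15 : ℕ) : ℕ∞) → M.E.ncard = 15 + 6 →
      (∀ e ∈ M.E, ∃ A ⊆ M.E \ {e}, e ∉ M.closure A ∧ e ∉ M.closure ((M.E \ {e}) \ A)) → RLS M 15 5)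
    (M : Matroid α) [M.Finite] (p : ℕ) (hp : 16 ≤ p) : RLS M p 5 := by
  refine c025_five_large_sharp16_of_two_cells ?_ M p hp
  intro M _ d hd6 hd7 hR hn hfree
  by_cases h7 : d = 7
  · subst h7
    exact c025_core_five_fifteen_seven M hR hn hfree
  · have h6 : d = 6 := by omega
    subst h6
    exact hsix M hR hn hfree

end ThmN

end PercRepro
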